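import Mathlib
import HarnessLib
import HarnessLib.Audit
import Summits.AnomalousDissipation.Statement
import Literature.Analysis.FunctionSpaces.HolderNorm
import Literature.Analysis.FluidPDE.TorusClassicalLerayHopf
import Literature.Analysis.FluidPDE.DissipationAnomaly
import Literature.Analysis.FluidPDE.TorusClassicalLerayHopfProofs
import HarnessLib.Audit.Status.Attr

/-!
Route: EulerLimit

DORMANT since 2026-08-25T08:53:51Z (reconciler: no traction for 7.6 d (last activity item-evidence-added at 2026-08-17T19:07:43Z); parked, not closed — `ledger route dormant route-AnomalousDissipation-EulerLimit --off` to reactivate) — unstaffed, not closed; items shared with open routes are served there. `ledger route dormant <id> --off` reactivates.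

# Route EulerLimit — AnomalousDissipation (Literature.Turb.ZerothLaw): the K41 vanishing-viscosity
picture stated literally

## Thesis X (words)
It suffices to show X = EulerlimitThesisV2 (target, stmt-AnomalousDissipation-0511): there are a
smooth steady divergence-free
mean-zero force f, a period τ > 0 and a τ-periodic weak solution u of the FORCED EULER equations on
T³ (forced weak NS with
ν = 0 on every [0,T)) with positive period input ∫₀^τ ∫⟪f,u(t)⟫ dt > 0 (equivalently positive mean
anomalous dissipation,
Duchon–Robert energy balance), which is the STRONG L³((0,τ)×T³) limit — junk-free ℝ≥0∞
nested-lintegral clause — of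
τ-periodic CLASSICAL Navier–Stokes solutions u_j with the SAME steady force f and viscosities ν_j →
0. The route splits X as
X ⇐ VanishingViscosityRealizationV2 (crux #2, realisation of a globally dissipative Hölder flow) via
the term-trivial
projection RealizationGivesThesis; GloballyDissipativePeriodicEulerFlow (crux #3) is the existence
half and kill switch.

Lean: `∃ f : UnitAddTorus (Fin 3) → EuclideanSpace ℝ (Fin 3),
Literature.Analysis.FunctionSpaces.Torus.IsSmooth f ∧
Literature.Analysis.FunctionSpaces.Torus.IsDivFree f ∧
Literature.Analysis.FunctionSpaces.Torus.HasZeroMean f ∧ ∃ (τ : ℝ) (u : ℝ → UnitAddTorus (Fin 3) →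
EuclideanSpace ℝ (Fin 3)), 0 < τ ∧ Function.Periodic u τ ∧ (∀ T : ℝ, 0 < T →
Literature.Analysis.FluidPDE.Torus.IsWeakNSSolutionForcedOn T 0 (fun _ => f) (u 0) u) ∧ 0 < ∫ t in
(0 : ℝ)..τ, MeasureTheory.integral MeasureTheory.volume (fun x => inner ℝ (f x) (u t x)) ∧ ∃ (ν : ℕ
→ ℝ) (us : ℕ → ℝ → UnitAddTorus (Fin 3) → EuclideanSpace ℝ (Fin 3)) (ps : ℕ → ℝ → UnitAddTorus (Fin
3) → ℝ), (∀ j, 0 < ν j) ∧ Filter.Tendsto ν Filter.atTop (nhds 0) ∧ (∀ j,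
Literature.Analysis.FunctionSpaces.Torus.IsClassicalNSSolutionOn Set.univ (ν j) (fun _ => f) (us j)
(ps j) ∧ Function.Periodic (us j) τ) ∧ Filter.Tendsto (fun j => MeasureTheory.lintegral
(MeasureTheory.Measure.restrict MeasureTheory.volume (Set.Ioo 0 τ)) (fun t =>
MeasureTheory.lintegral MeasureTheory.volume (fun x => ‖us j t x - u t x‖ₑ ^ 3))) Filter.atTop (nhds
0)`

## Assembly X → AnomalousDissipation
Deciding theorem (certified 2026-08-15, rev 5, authority native): `closes : EulerlimitThesisV2 →
VanishingViscosityRealizationV2 →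
GloballyDissipativePeriodicEulerFlow → RealizationGivesThesis → Assembly4 → AnomalousDissipation`,
proof
`hA energy_balance_holds gradNormSq_eq_toReal_eGradNormSq_holds
isGlobalLerayHopf_of_isClassicalNSSolutionOn_holds hX` — the three
named-fact antecedents of Assembly4 (stmt-0523) are DISCHARGED Literature theorems
(TorusFluidGlueProofs, TorusFourierCalculus,
TorusClassicalLerayHopfProofs; the route imports the last, which brings the other two), so the only
open glue is Assembly4 itself
(elementary, ~150 lines): Hölder L³ → L² on the finite-measure (0,τ)×T³ gives ∫₀^τ∫⟪f,u_j⟫ →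
∫₀^τ∫⟪f,u⟫ > 0 and bounded period
energies; PeriodAverageBalanceV2 (stmt-0513: period-integrated energy balance ν_j∫₀^τ‖∇u_j‖² =
∫₀^τ∫⟪f,u_j⟫ for τ-periodic classical
flows) with CesaroMeanPeriodic (stmt-0514: limsup means of continuous periodic functions are period
means; proved in tree,
Theorems/EulerLimitCesaro.lean) turns these into meanDissipation ≥ ε and meanEnergy ≤ E; reindex the
tail; the classical ⇒ global
Leray–Hopf bridge is the discharged fact isGlobalLerayHopf_of_isClassicalNSSolutionOn. Legacy
assemblies Assembly/Assembly2/Assembly3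
(stmt-0224/0439/0512) are superseded history (0224/0439 carry the ill-typed v1 antecedent) and are
NOT load-bearing; the gate refuses
--drop/ --retriage of assembly-kind items, so they stay listed until an operator removes them.

Rationale: WHY THIS LINE. The K41/Onsager picture of the summit is literally "u^ν → a dissipative weak Euler
solution with ⟨D⟩ = ε > 0" (Frisch1995 Ch. 5; DuchonRobert2000; Eyink2003); convex integration now
produces the Euler side — Hölder weak solutions with prescribed energy behaviour (Isett2018 =
arXiv:1608.08301; BDLSV2019 = arXiv:1701.08678), globally dissipative ones obeying the local energy
inequality (Isett2022 = arXiv:1710.11186, DeLellisKwon2022 = arXiv:2006.06482, GiriKwonNovack2023 =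
arXiv:2305.18509), forced ones (BulutHuynhPalasek2023 = arXiv:2301.00804) — while every printed
Navier–Stokes anomaly still uses ν-dependent forces (BrueDeLellis2023 = arXiv:2207.06301 Thm 1.1;
BCCDS2024 = arXiv:2212.08413 Thm 1; Cheskidov2023 = arXiv:2311.04182 Thm 1.3, time-periodic, f^{ν_j}
→ f). This route states the picture as a theorem shape in which the ONLY hard step is the
vanishing-viscosity realisation with one steady force (PROBLEMS.md §3: "convex integration gives
Euler, not Leray–Hopf — the thesis must upgrade"): time-periodicity makes limsup means equal period
means (no T → ∞ / ν → 0 interchange), classical approximants make the Leray–Hopf bridge a discharged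
Literature fact, and the junk-free strong-L³ clause makes X → ZerothLaw elementary (Assembly4).
Imported area: convex integration / Onsager theory (analysis of PDE); no probabilistic or spectral
reformulation is used. Nearest prior art and delta are in NOVELTY (grade variant: X =
BuckmasterVicol2020 §8 last problem = BrueDeLellis2023 Q.1 = BCCDS2024 Open Q.1, sharpened).
RANKED CRUXES. #2 VanishingViscosityRealizationV2 (stmt-AnomalousDissipation-1507) — some
τ-periodic, steady-forced, globally dissipative (Duchon–Robert defect D ≥ 0) Hölder weak Euler flow
with positive period input is the strong L³((0,τ)×T³) limit of τ-periodic CLASSICAL NS solutions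
with the SAME force and ν_j → 0 (why it might fail: ∃-bet with no named mechanism; no c.i. flow is
known to be a same-force classical ν→0 limit, BrueDeLellis2023 p.5 "widely open"; tracking a C^β
flow costs force work ~ν^((3β−1)/(1+β)) → ∞, BuckmasterVicol2020 Rem 6.4; sources arXiv:2207.06301,
arXiv:1901.09023, arXiv:2212.08413, arXiv:2305.18509). #3 GloballyDissipativePeriodicEulerFlow
(stmt-1516) — existence half: a τ-periodic steady-forced C⁰_t C^α_x weak Euler flow with ∫₀^τ∫⟪f,u⟫
> 0 and nonnegative Duchon–Robert defect on every (0,T) (why it might fail: printed globally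
dissipative flows are unforced, finite-window, with a monotone dissipation budget; periodicity + D ≥
0 force each period's input to equal the defect mass for a STEADY f and no scheme closes that loop
yet; sources arXiv:1710.11186, arXiv:2006.06482, arXiv:2305.18509, arXiv:2301.00804). Implications
1507 → 1516 → 0226 and 1507 → 0511 (RealizationGivesThesis, stmt-1754) are term-trivial projections.
KILL CRITERIA. A theorem "every bounded-energy family of classical τ-periodic NS solutions with ONE
steady smooth force has vanishing mean input defect as ν → 0 along any strong-L³-convergent
subsequence" (BuckmasterVicol2020 Rem 6.4 made rigorous for the periodic globally dissipative class)
refutes 1507 and the target and closes the route (close --reason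
refuted:VanishingViscosityRealizationV2). A refutation of 1516 (no τ-periodic steady-forced globally
dissipative Hölder flow with positive input) closes it too. A refutation must use the fixedness of
the single steady f
(Literature.Barriers.AnomalousDissipation.Cheskidov2023_thm13_not_forceRobustNoAnomaly: force-robust
estimates cannot refute X). If ZerothLaw is proved elsewhere by steady/exact NS states
(CoherentStates, FrozenK41, LambCircleTG) the route is moot but X stays of independent interest.
NOT DECOMPOSED YET. Which convex-integration scheme carries the steady force and the period
(intermittent vs homogeneous building blocks; Nash step with f lower order); the quantitative
L²/L³-stability of the building blocks under νΔ that 1507 needs (or a joint construction of u and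
u^{ν_j} à la BCCDS2024 with the ν-dependence removed); the non-concentration of the defect required
of a strong viscosity limit (DeRosaDrivasInversi2024). These become glued splits of 1507 only after
1516 closes.
CHEAPEST FALSIFIER. Test the ∀-shadow of 1507 on the one explicit family available: take a
BDLSV2019/Isett-type C^β periodic-in-time flow and the same-force smooth NS_ν solutions from the
τ-periodic data; BuckmasterVicol2020 Rem 6.4 predicts input work ≈ ν^((3β−1)/(1+β)) → ∞, i.e. NO
bounded-energy same-force approximants along that family — if a refuter can upgrade this heuristic
to "for every C^β flow with β < 1/3", 1507 dies; the 2½-D/shear special case is already dead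
(BardosTitiWiedemann2012: viscosity selects the conservative flow), so any witness must be genuinely
3-D.
SUPPORT. PeriodicForcedConvexIntegration (stmt-0226: #3 without the defect sign; expected provable
with current technology), PeriodAverageBalanceV2 (stmt-0513: period-integrated energy balance for
τ-periodic classical flows; provable now, its two fact premises are discharged), CesaroMeanPeriodic
(stmt-0514: proved in tree, Theorems/EulerLimitCesaro.lean, gate close pending),
RealizationGivesThesis (stmt-1754: provable now, projection), Assembly4 (stmt-0523: X → ZerothLaw
with three discharged fact antecedents; provable now, ~150 lines). Legacy
Assembly/Assembly2/Assembly3 (0224/0439/0512), EulerlimitThesis (0267, ill-typed v1) and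
VanishingViscosityRealization (0225, duplicate of the target) are superseded history — do not staff.
SOURCES. BuckmasterVicol2020 (arXiv:1901.09023 §8, Rem 6.4), BrueDeLellis2023 (arXiv:2207.06301),
BCCDS2024 (arXiv:2212.08413), Cheskidov2023 (arXiv:2311.04182), GiriKwonNovack2023
(arXiv:2305.18509), DeLellisKwon2022 (arXiv:2006.06482), Isett2022 (arXiv:1710.11186), BDLSV2019
(arXiv:1701.08678), BulutHuynhPalasek2023 (arXiv:2301.00804), DuchonRobert2000, Frisch1995,
arXiv:2512.24568, arXiv:2605.18126.

Novelty: NOVELTY (retriage 2026-08-14; searched lit frontier/bridges AnomalousDissipation, lit citing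
arXiv:2207.06301 (46 descendants to 2026-05), lit read of the pages below). Nearest prior art:
thesis X is, almost verbatim, the LAST open problem of BuckmasterVicol2020 §8 (arXiv:1901.09023
p.45: Leray–Hopf family, smooth ν-independent large-scale force, ε^ν → ε ∈ (0,∞) as long-time
average, AND v^ν → a dissipative weak Euler solution) = BrueDeLellis2023 Q.1 (arXiv:2207.06301 p.5)
= BCCDS2024 Open Q.1 (arXiv:2212.08413 p.4). Viscosity-limit realisation of convex-integration flows
is printed only for weak/Oseen NS solutions (BuckmasterVicol2019Annals Thm 1.3) and is called
"widely open" for classical ones (BrueDeLellis2023 p.5; arXiv:2512.24568 Rem 1.5). Every printed NS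
anomaly uses ν-dependent forces: BrueDeLellis2023 Thm 1.1, BCCDS2024 Thm 1, Cheskidov2023 Thm 1.3
(arXiv:2311.04182: smooth TIME-PERIODIC solutions, f^{ν_j} → f in C(R;L²), long-time averages — the
closest setting), arXiv:2512.24568 Thms 3.2–3.3, arXiv:2605.18126. Delta: no new mechanism (crux
0225 names no tool); the route contributes FRAMING only — same steady f instead of f^{ν_j} → f (vs
Cheskidov2023), time-periodicity so that limsup means are period means (no T→∞/ν→0 interchange),
classical approximants (LH bridge = landed fact), and a junk-free strong-L³ clause making X →
ZerothLaw elementary (0523 via 0513 + proved 0514). Self-assessed grade: variant (known open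
problem, new packaging). g2 addendum (2026-08-14,  [refs: 2207.06301, 1901.09023, 2212.08413, 2512.24568, 2311.04182, 2605.18126, 2305.18509, 2006.06482, 1710.11186, BuckmasterVicol2020, BrueDeLellis2023, BCCDS2024, Cheskidov2023, DuchonRobert2000]

Barriers (technique_class: convex-integration vanishing-viscosity-limit time-periodic): BARRIERS (retriage g2 2026-08-14: all 12 catalogued decls for AnomalousDissipation addressed;
technique_class unchanged).
- Literature.Barriers.AnomalousDissipation.BuckmasterVicol2019_thm13: APPLIES and names this crux —
convex integration reaches Navier–Stokes only in the weak (non-Leray) class (BV2019 Thm 1.3, §1.2).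
Not evaded: crux 0225 IS this gap; the bet is that some periodic forced wild flow admits same-force
classical approximants (against BV2020 Rem 6.4: naive approximants need forcing work
~ν^((3β−1)/(1+β)) → ∞).
- Literature.Barriers.AnomalousDissipation.BardosTitiWiedemann2012_thm5: applies to shear (2½-D)
witnesses — viscosity selects the conservative shear flow; X is ∃-form, so the witness must be
genuinely 3-D: a constraint, not a refutation.
- Literature.Barriers.AnomalousDissipation.Cheskidov2023_thm21_noDissipationAnomaly: blocks
"dissipative limit ⇒ the family dissipates"; evaded — assembly 0523 (via 0513 + proved 0514) reads
dissipation off the exact period balance ν_j∫₀^τ‖∇u_j‖² = ∫₀^τ(f,u_j) of classical periodic flows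
plus strong-L³ convergence of the input, never from the limit's defect.
- Literature.Barriers.AnomalousDissipation.DrivasEyink2019_lemma1: constraint only — the
approximants u_j cannot stay bounded in L³_t B^σ_(3,∞) for σ > 1/3; consistent (the limit is C^α
with α < 1/3).
- Literature.Barriers.AnomalousDissipation.DeRosaIsett2024_thm213: constraint only — if the limiting
dissipation measure of the u_j were carried by a set of space–time

Novelty grade: variant — ROUTE REVIEW refuter-rreview1 2026-08-15. variant: X(0511) = BV2020 §8 last problem = BDL2023 Q1+Q2 + 'widely open' classical-approximation problem (p.5, read today) = BCCDS2024 OQ1, re-set with ONE steady f, common period τ, CLASSICAL approximants, junk-free strong-L³ clause; no mechanism (planner  (refuter refuter-rreview1-AnomalousDissipation-EulerLimi-5b23f787-0, 2026-08-15T18:26:02Z; prior: arXiv:1901.09023 §8 last problem p.45 + Rem 6.4 p.27 (BuckmasterVicol2020), arXiv:2207.06301 p.5 Q.1, Q.2 + 'widely open' paragraph (BrueDeLellis2023; read today), arXiv:2212.08413 p.4 Open Q.1 (BCCDS2024), arXiv:2311.04182 Thm 1.3 (Cheskidov2023), arXiv:2208.08290 pp.5-6 Thm 1.3/§5-6 (HofmanovaZhuZhu2022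 ARMA; NEW ref, not in route), arXiv:1809.00600 Thm 1.3 (= Barriers.BuckmasterVicol2019_thm13))

History (route lifecycle, newest last):
- 2026-08-16T03:41:18Z · AUTO-CRUX (backfill): EulerlimitThesisV2 — hypotheses of the deciding theorem that nothing in the route derives are cruxes (operator:999:586464)
- 2026-08-16T14:43:05Z · LINT AUTOFIX route.multi-assembly: kept Assembly4, dropped Assembly, Assembly2, Assembly3 (gate:hygiene)
- 2026-08-25T08:53:51Z · DORMANT — reconciler: no traction for 7.6 d (last activity item-evidence-added at 2026-08-17T19:07:43Z); parked, not closed — `ledger route dormant route-AnomalousDissipa (operator:999:2756558)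

sub-problem: AnomalousDissipation · status: dormant · opened planner-AnomalousDissipation-Survey-0 2026-08-13T06:06:43Z · rev 8 · ledger route-AnomalousDissipation-EulerLimit
GENERATED by the gate from the ledger (D-0016/17). Provers cite these decls: `theorem foo : Summit.AnomalousDissipation.AnomalousDissipation.Theses.EulerLimit.<Decl> := …` in Summits/AnomalousDissipation/AnomalousDissipation/Theorems/<Name>.lean.
-/

namespace Summit.AnomalousDissipation.AnomalousDissipation.Theses.EulerLimit

open scoped BigOperators Topology Manifold Classical MeasureTheory ProbabilityTheory Matrix InnerProductSpace ComplexConjugate ContinuousMap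
open Filter Set Function TopologicalSpace MeasureTheory

attribute [summit_statement] _root_.AnomalousDissipation

open Literature.Turb

/-- item stmt-AnomalousDissipation-0511 · crux (kind.auto-crux: conjecture-grade) · rank 0 · open · by planner
why it might fail: X = BV2020 §8 last problem = BDL2023 Q.1+Q.2 = BCCDS2024 Open Q.1, τ-periodic, strong-L³ form; false if every bounded-energy classical NS family with one steady smooth force has vanishing mean input defect as ν→0 (kill criterion; BV2020 Rem 6.4; limit must be globally dissipative, GKN2023).
sources: BuckmasterVicol2020 = arXiv:1901.09023 §8 last problem (p.45) and Rem. 6.4 (p.27), BrueDeLellis2023 = arXiv:2207.06301 p.5 Questions 1–2 and the 'widely open' paragraph; Thm 1.1 (p.4, ν-dependent smooth forces f^{ν_m}), BCCDS2024 = arXiv:2212.08413 p.4 Open Question 1; Thm 1 (p.3, ν-dependent F_ν), Cheskidov2023 = arXiv:2311.04182 Thm 1.3 (time-periodic, f^{ν_j} → f) = Literature.Analysis.FluidPDE.cheskidov_time_periodic_anomaly; arXiv:2512.24568 p.1 ('still not known to arise as vanishing-viscosity limits'); arXiv:2605.18126 Thm 1.2 (ν-dependent f^{μ_m}), GiriKwonNovack2023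 = arXiv:2305.18509 p.3 (strong L³ limits satisfy the local energy inequality); Literature.Analysis.FluidPDE.Torus.IsDissipationMeasureOf.hasDuchonRobertDefect (DuchonRobert2000 Prop. 4), Literature.Barriers.AnomalousDissipation.BuckmasterVicol2019_thm13
SUPERSEDES thesis stmt-AnomalousDissipation-0267 (refuter-refute-A-0, 06:53Z: ILLTYPED — the
strong-L³ vanishing-viscosity clause was a nested BOCHNER integral, hence satisfied vacuously
(integral_undef junk 0 → 0) whenever the Euler slices u t ∉ L³; with STEADY NS solutions being
τ-periodic for every τ, X-as-typed = intended X ∨ junk branch skipping crux #2 entirely). FIX F1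
applied verbatim: the last conjunct is now ℝ≥0∞-valued, `Tendsto (fun j => ∫⁻ t in Ioo 0 τ, ∫⁻ x,
‖us j t x − u t x‖ₑ ^ 3) atTop (nhds 0)` (written with explicit MeasureTheory.lintegral /
Measure.restrict volume (Set.Ioo 0 τ) so it elaborates without `open`). Off L³ the inner lintegral
is ⊤, so convergence to 0 forces u ∈ L³((0,τ)×T³) and genuine strong L³ convergence us_j → u; joint
a.e.-measurability of u comes from IsWeakNSSolutionForcedOn (AEStronglyMeasurable of the space-time
lift), us_j smooth. Everything else is 0267 character-for-character: ∃ smooth div-free mean-zero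
steady f, τ > 0, a τ-periodic global weak forced-Euler u (IsWeakNSSolutionForcedOn T 0 f (u 0) u for
all T) with positive period input ∫₀^τ∫⟪f,u⟫ > 0 (Bochner; junk 0 would violate 0 < ·, safe
direction), realised as the strong L³_{t,x}( -/
@[route_item "route-AnomalousDissipation-EulerLimit", crux]
def EulerlimitThesisV2 : Prop :=
  ∃ f : UnitAddTorus (Fin 3) → EuclideanSpace ℝ (Fin 3), Literature.Analysis.FunctionSpaces.Torus.IsSmooth f ∧ Literature.Analysis.FunctionSpaces.Torus.IsDivFree f ∧ Literature.Analysis.FunctionSpaces.Torus.HasZeroMean f ∧ ∃ (τ : ℝ) (u : ℝ → UnitAddTorus (Fin 3) → EuclideanSpace ℝ (Fin 3)), 0 < τ ∧ Function.Periodic u τ ∧ (∀ T : ℝ, 0 < T → Literature.Analysis.FluidPDE.Torus.IsWeakNSSolutionForcedOn T 0 (fun _ => f) (u 0) u) ∧ 0 < ∫ t in (0 : ℝ)..τ, MeasureTheory.integral MeasureTheory.volume (fun x => inner ℝ (f x) (u t x)) ∧ ∃ (ν : ℕ → ℝ) (us : ℕ → ℝ → UnitAddTorus (Fin 3) → EuclideanSpace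 ℝ (Fin 3)) (ps : ℕ → ℝ → UnitAddTorus (Fin 3) → ℝ), (∀ j, 0 < ν j) ∧ Filter.Tendsto ν Filter.atTop (nhds 0) ∧ (∀ j, Literature.Analysis.FunctionSpaces.Torus.IsClassicalNSSolutionOn Set.univ (ν j) (fun _ => f) (us j) (ps j) ∧ Function.Periodic (us j) τ) ∧ Filter.Tendsto (fun j => MeasureTheory.lintegral (MeasureTheory.Measure.restrict MeasureTheory.volume (Set.Ioo 0 τ)) (fun t => MeasureTheory.lintegral MeasureTheory.volume (fun x => ‖us j t x - u t x‖ₑ ^ 3))) Filter.atTop (nhds 0)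

/-- item stmt-AnomalousDissipation-1507 · crux · rank 2 · open · by planner
why it might fail: ∃-bet with no named mechanism: strong-L³ limits of classical NS obey the local energy inequality (arXiv:2305.18509 p.3), yet no c.i. flow is known to be a same-force classical ν→0 limit (BDL2023 p.5 'widely open'); tracking a C^β flow costs force work ~ν^((3β−1)/(1+β))→∞ (BV2020 Rem 6.4).
sources: BrueDeLellis2023 = arXiv:2207.06301 p.5: Question 1 (f^{ν_m} independent of ν_m) and the 'widely open' paragraph (classical vanishing-viscosity approximation of c.i. flows); Thm 1.1 uses ν-dependent forces, BuckmasterVicol2020 = arXiv:1901.09023 Rem. 6.4 (p.27: same-family smooth NS approximants need force work ≈ ν^((3β−1)/(1+β)), unbounded for β < 1/3) and §8 last problem (p.45: ν-independent smooth force, ε^ν → ε ∈ (0,∞), v^ν → dissipative weak Euler), BCCDS2024 = arXiv:2212.08413 p.4 Open Question 1 (Leray solutions with a ν-independent force); Thm 1 (p.3) uses ν-dependent F_ν, GiriKwonNovack2023 = arXiv:2305.18509 (Ann. of Math. 204 (2026), doi:10.4007/annals.2026.204.1.4) p.3: strong L³_{x,t} limits of NS satisfy the local energy inequality; Thm 1.1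 globally dissipative B^{1/3−}_{3,∞} flows (unforced, finite window), DeLellisKwon2022 = arXiv:2006.06482 (doi:10.2140/apde.2022.15.2003) p.3 and Thm 1.1 (globally dissipative C^{1/7−}); Isett2022 = arXiv:1710.11186 (doi:10.1007/s00205-022-01780-6) Thms 1, 4 (C^{1/15−}), Cheskidov2023 = arXiv:2311.04182 Thm 1.3 (smooth τ-periodic NS solutions with forces f^{ν_j} → f in C(R;L²): nearest proved NS-side result, ν-dependent forces); CheskidovPeng2025 = arXiv:2512.24568 Rem 1.5; arXiv:2605.18126 Thm 1.2 (still ν-dependent forces)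
[crux] Realisation half of X (re-plan 2026-08-15 per retriage g2; SUPERSEDES 0225, whose signature
duplicated target 0511). Some flow of the GloballyDissipativePeriodicEulerFlow class — steady smooth
div-free mean-zero f, τ-periodic u ∈ C⁰_t C^α_x (α > 0), weak forced Euler on every [0,T), period
input ∫₀^τ∫⟪f,u⟫ > 0, nonnegative Duchon–Robert defect on every (0,T) (local energy inequality,
necessary for strong-L³ limits of classical flows: GKN2023 p.3 / DuchonRobert2000 Prop. 4) — is the
strong L³((0,τ)×T³) limit (junk-free nested-lintegral clause of 0511) of τ-periodic CLASSICAL NS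
solutions with the SAME force f and ν_j → 0. ∃ over the class (∀-form expected false,
BrueDeLellis2023 p.5). V2 → X (glue RealizationGivesThesis) and V2 → the existence crux are
term-trivial (Sketch, lean rc 0). = BuckmasterVicol2020 §8 last problem / BrueDeLellis2023 Q.1 /
BCCDS2024 Open Q.1, sharpened (Hölder, globally dissipative, τ-periodic, strong L³); no tool known —
candidates: quantitative L²-stability of intermittent building blocks under νΔ along the scheme;
building u and u^{ν_j} together (BCCDS2024 does so with ν-dependent forces). Import
DissipationAnomaly adds no unproved fact. WHY IT MIG -/
@[route_item "route-AnomalousDissipation-EulerLimit", crux]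
def VanishingViscosityRealizationV2 : Prop :=
  ∃ f : UnitAddTorus (Fin 3) → EuclideanSpace ℝ (Fin 3), Literature.Analysis.FunctionSpaces.Torus.IsSmooth f ∧ Literature.Analysis.FunctionSpaces.Torus.IsDivFree f ∧ Literature.Analysis.FunctionSpaces.Torus.HasZeroMean f ∧ ∃ (τ : ℝ) (u : ℝ → UnitAddTorus (Fin 3) → EuclideanSpace ℝ (Fin 3)), 0 < τ ∧ Function.Periodic u τ ∧ (∃ α : NNReal, 0 < α ∧ Literature.Analysis.FunctionSpaces.ContinuousInHolderOn Set.univ α u) ∧ (∀ T : ℝ, 0 < T → Literature.Analysis.FluidPDE.Torus.IsWeakNSSolutionForcedOn T 0 (fun _ => f) (u 0) u) ∧ 0 < ∫ t in (0 : ℝ)..τ, MeasureTheory.integral MeasureTheory.volume (fun x => inner ℝ (f x) (u t x)) ∧ (∀ T : ℝ, 0 < T → ∃ D : Literature.Analysis.FluidPDE.Torus.STFunctional (Fin 3), Literature.Analysis.FluidPDE.Torus.HasDuchonRobertDefect T u D ∧ ∀ ψ : ℝ → UnitAddTorus (Fin 3) → ℝ, Literature.Analysis.FunctionSpaces.Torus.IsSpaceTimeTestIoo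 T ψ → (∀ t x, 0 ≤ ψ t x) → 0 ≤ D ψ) ∧ ∃ (ν : ℕ → ℝ) (us : ℕ → ℝ → UnitAddTorus (Fin 3) → EuclideanSpace ℝ (Fin 3)) (ps : ℕ → ℝ → UnitAddTorus (Fin 3) → ℝ), (∀ j, 0 < ν j) ∧ Filter.Tendsto ν Filter.atTop (nhds 0) ∧ (∀ j, Literature.Analysis.FunctionSpaces.Torus.IsClassicalNSSolutionOn Set.univ (ν j) (fun _ => f) (us j) (ps j) ∧ Function.Periodic (us j) τ) ∧ Filter.Tendsto (fun j => MeasureTheory.lintegral (MeasureTheory.Measure.restrict MeasureTheory.volume (Set.Ioo 0 τ)) (fun t => MeasureTheory.lintegral MeasureTheory.volume (fun x => ‖us j t x - u t x‖ₑ ^ 3))) Filter.atTop (nhds 0)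

/-- item stmt-AnomalousDissipation-1516 · crux · rank 3 · open · by planner
why it might fail: Printed globally dissipative flows (arXiv:1710.11186 C^{1/15−}, 2006.06482 C^{1/7−}, 2305.18509 B^{1/3−}) are unforced, finite-window, monotone dissipation budget; here D ≥ 0 + τ-periodicity force each period's input ∫₀^τ(f,u) to equal the defect mass for a STEADY f — no scheme closes that loop yet.
sources: BDLSV2019 = arXiv:1701.08678 Thm 1.3 (h-principle: C^β weak Euler flows, β < 1/3, near any smooth strict subsolution; unforced, [0,T]) and Thm 1.1 (prescribed energy profile), Isett2022 = arXiv:1710.11186 Thms 1 and 4: continuous GLOBALLY DISSIPATIVE (local energy inequality) Euler flows, C^{1/15−}, unforced, finite window, DeLellisKwon2022 = arXiv:2006.06482 Thm 1.1: Hölder C^{1/7−} globally dissipative Euler flows (unforced, finite window), GiriKwonNovack2023 = arXiv:2305.18509 Thm 1.1 (Ann. of Math. 204 (2026)): globally dissipative flows in C⁰_t(B^{1/3−}_{3,∞} ∩ L^{1/(1−3β)}), unforced, finite window, BulutHuynhPalasek2023 = arXiv:2301.00804 Thm 1.1 (forced convex integration above the Onsager exponent; the force is CONSTRUCTED, not prescribed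 — grounder correction on 0226 stands), HofmanovaZhuZhu2022 (stochastic/rough additive forcing tolerated by Hölder convex-integration schemes: a smooth steady f is lower order in the Nash step)
[crux] Existence half of X: a GLOBALLY DISSIPATIVE τ-periodic steady-forced Hölder weak Euler flow
with positive period input — ∃ f smooth steady div-free mean-zero, τ > 0, u τ-periodic, C⁰_t C^α_x
for some α > 0 (Literature.Analysis.FunctionSpaces.ContinuousInHolderOn), IsWeakNSSolutionForcedOn T
0 (fun _ => f) (u 0) u for all T > 0, ∫₀^τ∫⟪f,u⟫ > 0, and for every T > 0 a Duchon–Robert defect D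
of u on (0,T) (Literature.Analysis.FluidPDE.Torus.HasDuchonRobertDefect T u D) that is nonnegative
on nonnegative test functions (IsSpaceTimeTestIoo). = support 0226 ∧ (D ≥ 0); strictly stronger than
every printed construction (globally dissipative flows are unforced and finite-window: Isett2022,
DeLellisKwon2022, GiriKwonNovack2023; forced/periodic c.i. flows carry no defect sign). Expected
provable by known technology but unprinted; it is the natural first milestone and a kill switch for
the route (V2 → this). For a τ-periodic flow with D ≥ 0 the period input equals the defect mass per
period, so positivity of ∫₀^τ(f,u) is exactly 'the flow dissipates anomalously'. WHY IT MIGHT FAIL: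
Printed globally dissipative flows (arXiv:1710.11186 C^{1/15−}, 2006.06482 C^{1/7−}, 2305.18509
B^{1/3−}) a -/
@[route_item "route-AnomalousDissipation-EulerLimit", crux]
def GloballyDissipativePeriodicEulerFlow : Prop :=
  ∃ f : UnitAddTorus (Fin 3) → EuclideanSpace ℝ (Fin 3), Literature.Analysis.FunctionSpaces.Torus.IsSmooth f ∧ Literature.Analysis.FunctionSpaces.Torus.IsDivFree f ∧ Literature.Analysis.FunctionSpaces.Torus.HasZeroMean f ∧ ∃ (τ : ℝ) (u : ℝ → UnitAddTorus (Fin 3) → EuclideanSpace ℝ (Fin 3)), 0 < τ ∧ Function.Periodic u τ ∧ (∃ α : NNReal, 0 < α ∧ Literature.Analysis.FunctionSpaces.ContinuousInHolderOn Set.univ α u) ∧ (∀ T : ℝ, 0 < T → Literature.Analysis.FluidPDE.Torus.IsWeakNSSolutionForcedOn T 0 (fun _ => f) (u 0) u) ∧ 0 < ∫ t in (0 : ℝ)..τ, MeasureTheory.integral MeasureTheory.volume (fun x => inner ℝ (f x) (u t x)) ∧ ∀ T : ℝ, 0 < T → ∃ D : Literature.Analysis.FluidPDE.Torus.STFunctional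 (Fin 3), Literature.Analysis.FluidPDE.Torus.HasDuchonRobertDefect T u D ∧ ∀ ψ : ℝ → UnitAddTorus (Fin 3) → ℝ, Literature.Analysis.FunctionSpaces.Torus.IsSpaceTimeTestIoo T ψ → (∀ t x, 0 ≤ ψ t x) → 0 ≤ D ψ

/-- item stmt-AnomalousDissipation-0267 · support · rank 0 · open · by planner
K41 stated literally (Frisch1995 Ch.5; DuchonRobert2000; Eyink2003): u^{ν_j} → u strongly in
L³((0,τ)×T³), u τ-periodic weak Euler with force f and ∫₀^τ (f,u) > 0 (= τ·mean Duchon–Robert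
dissipation). Sources for existence side: Isett2018, BDLSV2019, BulutHuynhPalasek2023, BCCDS2024. -/
@[route_item "route-AnomalousDissipation-EulerLimit"]
def EulerlimitThesis : Prop :=
  ∃ f : UnitAddTorus (Fin 3) → EuclideanSpace ℝ (Fin 3), Literature.Analysis.FunctionSpaces.Torus.IsSmooth f ∧ Literature.Analysis.FunctionSpaces.Torus.IsDivFree f ∧ Literature.Analysis.FunctionSpaces.Torus.HasZeroMean f ∧ ∃ (τ : ℝ) (u : ℝ → UnitAddTorus (Fin 3) → EuclideanSpace ℝ (Fin 3)), 0 < τ ∧ Function.Periodic u τ ∧ (∀ T : ℝ, 0 < T → Literature.Analysis.FluidPDE.Torus.IsWeakNSSolutionForcedOn T 0 (fun _ => f) (u 0) u) ∧ 0 < ∫ t in (0 : ℝ)..τ, MeasureTheory.integral MeasureTheory.volume (fun x => inner ℝ (f x) (u t x)) ∧ ∃ (ν : ℕ → ℝ) (us : ℕ → ℝ → UnitAddTorus (Fin 3) → EuclideanSpace ℝ (Fin 3)) (ps : ℕ → ℝ → UnitAddTorus (Fin 3) → ℝ), (∀ j, 0 < ν j) ∧ Filter.Tendsto ν Filter.atTop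 (nhds 0) ∧ (∀ j, Literature.Analysis.FunctionSpaces.Torus.IsClassicalNSSolutionOn Set.univ (ν j) (fun _ => f) (us j) (ps j) ∧ Function.Periodic (us j) τ) ∧ Filter.Tendsto (fun j => ∫ t in (0 : ℝ)..τ, MeasureTheory.integral MeasureTheory.volume (fun x => ‖us j t x - u t x‖ ^ 3)) Filter.atTop (nhds 0)

/-- item stmt-AnomalousDissipation-0225 · support · rank 2 · open · by planner
why it might fail: ∃-bet that SOME periodic c.i. flow is a same-force classical ν→0 limit: such limits obey the local energy inequality (GKN2023 p.3); most c.i. flows are not Leray limits (BDL2023 p.5); tracking costs force work ~ν^((3β−1)/(1+β))→∞ (BV2020 Rem 6.4); shear data select the conservative flow (BTW2012).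
sources: BrueDeLellis2023 = arXiv:2207.06301 p.5: Question 1 (f^{ν_m} independent of ν_m) and the paragraph 'most of the dissipative solutions produced by these methods cannot arise as vanishing viscosity limits of Leray solutions … [for] a classical vanishing viscosity approximation … a widely open problem', BuckmasterVicol2020 = arXiv:1901.09023 Rem. 6.4 (p.27: same-family smooth NS approximants exist but the work of the force ≈ ν^((3β−1)/(1+β)) is unbounded for β < 1/3) and §8 last problem (p.45: smooth forcing at ν-independent scales, ε^ν → ε ∈ (0,∞), v^ν → dissipative weak Euler solution), BCCDS2024 = arXiv:2212.08413 p.4 Open Question 1 ('Can Theorem 1 be shown for Leray solutions but replacing F_ν with a ν-independent force …?'); Thm 1 (p.3) uses ν-dependent forces F_ν, GiriKwonNovack2023 = arXiv:2305.18509 p.3 ('if u^ν → u in the L³_{x,t} topology, then u must be a weak solution to Euler satisfying the local energy inequality') + Thm 1.1 (globally dissipative flows in C⁰_t(B^β_{3,∞} ∩ L^{1/(1−3β)}), β < 1/3, unforced, finite window), DeLellisKwon2022 = arXiv:2006.06482 (doi:10.2140/apde.2022.15.2003) p.3 (Isett's observation: strong L³ limits of suitable NS solutions satisfy the local energy inequality)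 + Thm 1.1 (globally dissipative C^β flows, β < 1/7); Isett2022 = arXiv:1710.11186 Thm 1 and Thm 4 (C^{1/15−}), Cheskidov2023 = arXiv:2311.04182 Thm 1.3 (smooth time-periodic NS solutions, forces f^{ν_j} → f in C(R;L²)) = fact Literature.Analysis.FluidPDE.cheskidov_time_periodic_anomaly; CheskidovPeng2025 = arXiv:2512.24568 p.1 and Rem. 1.5, Li2026 = arXiv:2605.18126 Thm 1.2: newest NS anomalies, still ν-d…
The 'upgrade' step of PROBLEMS.md §3. ∃-form (a specific convex-integration solution suffices); the
∀-form is expected false (wild solutions are generically not viscosity limits). No known tool;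
candidate mechanisms: quantitative stability of intermittent building blocks under νΔ, or
constructing u and u^{ν} simultaneously (BCCDS2024 builds NS solutions with forces f^{ν}; here the
force may not depend on ν). Informal because it quantifies over the witness of #3; its Lean form is
the thesis E0 itself. -/
@[route_item "route-AnomalousDissipation-EulerLimit"]
def VanishingViscosityRealization : Prop :=
  ∃ f : UnitAddTorus (Fin 3) → EuclideanSpace ℝ (Fin 3), Literature.Analysis.FunctionSpaces.Torus.IsSmooth f ∧ Literature.Analysis.FunctionSpaces.Torus.IsDivFree f ∧ Literature.Analysis.FunctionSpaces.Torus.HasZeroMean f ∧ ∃ (τ : ℝ) (u : ℝ → UnitAddTorus (Fin 3) → EuclideanSpace ℝ (Fin 3)), 0 < τ ∧ Function.Periodic u τ ∧ (∀ T : ℝ, 0 < T → Literature.Analysis.FluidPDE.Torus.IsWeakNSSolutionForcedOn T 0 (fun _ => f) (u 0) u) ∧ 0 < ∫ t in (0 : ℝ)..τ, MeasureTheory.integral MeasureTheory.volume (fun x => inner ℝ (f x) (u t x)) ∧ ∃ (ν : ℕ → ℝ) (us : ℕ → ℝ → UnitAddTorus (Fin 3) → EuclideanSpace ℝ (Fin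 3)) (ps : ℕ → ℝ → UnitAddTorus (Fin 3) → ℝ), (∀ j, 0 < ν j) ∧ Filter.Tendsto ν Filter.atTop (nhds 0) ∧ (∀ j, Literature.Analysis.FunctionSpaces.Torus.IsClassicalNSSolutionOn Set.univ (ν j) (fun _ => f) (us j) (ps j) ∧ Function.Periodic (us j) τ) ∧ Filter.Tendsto (fun j => MeasureTheory.lintegral (MeasureTheory.Measure.restrict MeasureTheory.volume (Set.Ioo 0 τ)) (fun t => MeasureTheory.lintegral MeasureTheory.volume (fun x => ‖us j t x - u t x‖ₑ ^ 3))) Filter.atTop (nhds 0)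

/-- item stmt-AnomalousDissipation-0226 · support · rank 3 · open · by planner
sources: BDLSV2019 = arXiv:1701.08678 p.3 Thm 1.1 (prescribed e(t)) and Thm 1.3 (h-principle: C^β flows, β < 1/3, weak-* close to any smooth strict subsolution; unforced, [0,T]), BulutHuynhPalasek2023 = arXiv:2301.00804 p.2 Thm 1.1 (the force div F is CONSTRUCTED, not prescribed — grounder correction stands), Isett2018 = arXiv:1608.08301 Thm 1 (compact time support, unforced — incompatible with a steady f ≠ 0), DuchonRobert2000 (period input = period-integrated defect D(u) for a τ-periodic weak solution); acq-00125 still unreadable, HofmanovaZhuZhu2022 and arXiv:2009.09552-type stochastic Euler constructions: convex integration in Hölder classes tolerates (even rough, time-dependent) additive forcing — a smooth steady f is lower order in the Nash step, GiriKwonNovack2023 = arXiv:2305.18509 p.3 and DeLellisKwon2022 = arXiv:2006.06482 Thm 1.1: the witness X actually needs must in addition satisfy the local energy inequality (not required by this item as typed)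
Convex integration with forcing (BulutHuynhPalasek2023) made τ-periodic in time; positive input =
positive mean Duchon–Robert defect by the distributional energy balance (DuchonRobert2000). Expected
provable with current technology; C⁰_t C^α_x for some α > 0 recorded via
Literature.Analysis.FunctionSpaces.ContinuousInHolderOn. -/
@[route_item "route-AnomalousDissipation-EulerLimit"]
def PeriodicForcedConvexIntegration : Prop :=
  ∃ f : UnitAddTorus (Fin 3) → EuclideanSpace ℝ (Fin 3), Literature.Analysis.FunctionSpaces.Torus.IsSmooth f ∧ Literature.Analysis.FunctionSpaces.Torus.IsDivFree f ∧ Literature.Analysis.FunctionSpaces.Torus.HasZeroMean f ∧ ∃ (τ : ℝ) (u : ℝ → UnitAddTorus (Fin 3) → EuclideanSpace ℝ (Fin 3)), 0 < τ ∧ Function.Periodic u τ ∧ (∃ α : NNReal, 0 < α ∧ Literature.Analysis.FunctionSpaces.ContinuousInHolderOn Set.univ α u) ∧ (∀ T : ℝ, 0 < T → Literature.Analysis.FluidPDE.Torus.IsWeakNSSolutionForcedOn T 0 (fun _ => f) (u 0) u) ∧ 0 < ∫ t in (0 : ℝ)..τ, MeasureTheory.integral MeasureTheory.volume (fun x =>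 inner ℝ (f x) (u t x))

/-- item stmt-AnomalousDissipation-0227 · support · rank 4 · open · by planner
Literature.Analysis.FunctionSpaces.Torus.IsClassicalNSSolutionOn.energy_balance (named fact)
integrated over a period + Cesàro means of a periodic locally integrable function converge to its
period mean; Literature.Analysis.FluidPDE.meanDissipation_eq_dissipationRate-type identification of
spectral and classical gradient norms (Torus.gradNormSq_eq_toReal_eGradNormSq, named fact) may be
taken as hypotheses. -/
@[route_item "route-AnomalousDissipation-EulerLimit"]
def PeriodicEnergyBalance : Prop :=
  ∀ (ν τ : ℝ) (f : UnitAddTorus (Fin 3) → EuclideanSpace ℝ (Fin 3)) (u : ℝ → UnitAddTorus (Fin 3) → EuclideanSpace ℝ (Fin 3)) (p : ℝ → UnitAddTorus (Fin 3) → ℝ), 0 < τ → Literature.Analysis.FunctionSpaces.Torus.IsClassicalNSSolutionOn Set.univ ν (fun _ => f) u p → Function.Periodic u τ → (∫ t in (0 : ℝ)..τ, ν * Literature.Analysis.FunctionSpaces.Torus.gradNormSq (u t)) = ∫ t in (0 : ℝ)..τ, MeasureTheory.integral MeasureTheory.volume (fun x => inner ℝ (f x) (u t x)) ∧ Literature.Analysis.FluidPDE.meanDissipation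 ν u = τ⁻¹ * ∫ t in (0 : ℝ)..τ, ν * Literature.Analysis.FunctionSpaces.Torus.gradNormSq (u t) ∧ Literature.Analysis.FluidPDE.meanEnergy u = τ⁻¹ * ∫ t in (0 : ℝ)..τ, MeasureTheory.integral MeasureTheory.volume (fun x => ‖u t x‖ ^ 2)

/-- item stmt-AnomalousDissipation-0513 · support · rank 4 · open · by planner
SUPERSEDES support lemma stmt-AnomalousDissipation-0227 (refuter-refute-A-0, 06:53Z:
CHECKED-AS-TYPED, TRUE, but the two Prop-facts the proof uses must be hypotheses IN the signature —
'planner please re-sign'). Now: (ha :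
Literature.Analysis.FunctionSpaces.Torus.IsClassicalNSSolutionOn.energy_balance (d := Fin 3)) → (hb
: Literature.Analysis.FunctionSpaces.Torus.gradNormSq_eq_toReal_eGradNormSq (d := Fin 3)) → 0227
verbatim. Both are `def … : Prop` named facts in
Literature/Analysis/FunctionSpaces/TorusFluidGlue.lean (lines 230, 132; implicit {d}, hence the (d
:= Fin 3)). Content: for a τ-periodic classical solution on all of ℝ with steady force f: (1)
ν∫₀^τ‖∇u‖² = ∫₀^τ∫⟪f,u⟫ (integrate ha over a period: HasDerivWithinAt on the convex set univ ⇒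
HasDerivAt ⇒ intervalIntegral.integral_eq_sub_of_hasDerivAt; periodicity kills E(τ) − E(0)); (2)
meanDissipation ν u = τ⁻¹∫₀^τ ν‖∇u‖² (hb slice-wise turns (eGradNormSq (u t)).toReal into gradNormSq
(u t), slices smooth from IsSmoothSpaceTimeOn univ; then the Cesàro lemma E5, filed separately and
provable now, gives Tendsto of the running means ⇒ limsup = limit via Tendsto.limsup_eq); (3)
meanEnergy u = τ⁻¹∫₀^τ‖u‖² likewise (meanEnergy = lo -/
@[route_item "route-AnomalousDissipation-EulerLimit"]
def PeriodAverageBalanceV2 : Prop :=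
  Literature.Analysis.FunctionSpaces.Torus.IsClassicalNSSolutionOn.energy_balance (d := Fin 3) → Literature.Analysis.FunctionSpaces.Torus.gradNormSq_eq_toReal_eGradNormSq (d := Fin 3) → ∀ (ν τ : ℝ) (f : UnitAddTorus (Fin 3) → EuclideanSpace ℝ (Fin 3)) (u : ℝ → UnitAddTorus (Fin 3) → EuclideanSpace ℝ (Fin 3)) (p : ℝ → UnitAddTorus (Fin 3) → ℝ), 0 < τ → Literature.Analysis.FunctionSpaces.Torus.IsClassicalNSSolutionOn Set.univ ν (fun _ => f) u p → Function.Periodic u τ → (∫ t in (0 : ℝ)..τ, ν * Literature.Analysis.FunctionSpaces.Torus.gradNormSq (u t)) = ∫ t in (0 : ℝ)..τ, MeasureTheory.integral MeasureTheory.volume (fun x => inner ℝ (f x) (u t x)) ∧ Literature.Analysis.FluidPDE.meanDissipation ν u = τ⁻¹ * ∫ t in (0 : ℝ)..τ, ν * Literature.Analysis.FunctionSpaces.Torus.gradNormSq (u t) ∧ Literature.Analysis.FluidPDE.meanEnergy u = τ⁻¹ * ∫ t in (0 : ℝ)..τ, MeasureTheory.integral MeasureTheory.volume (fun x => ‖u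 t x‖ ^ 2)

/-- item stmt-AnomalousDissipation-0514 · support · rank 5 · closed · proved by Summit.AnomalousDissipation.AnomalousDissipation.Theorems.cesaroMeanPeriodic_proof (prover) · by planner
NEW standalone support lemma requested by refuter-refute-A-0 (0227 note: 'the
Cesàro-mean-of-periodic-function lemma is independently useful — file it standalone (pure real
analysis, provable now without any fact)'). For g : ℝ → ℝ continuous and τ-periodic, τ > 0: timeMean
g T = T⁻¹∫₀ᵀ g → τ⁻¹∫₀^τ g as T → ∞, and hence longTimeAvgSup g (= Filter.limsup (timeMean g) atTop,
TurbWave0.lean:89) equals τ⁻¹∫₀^τ g. Proof (~80–120 lines): write T = nτ + r, 0 ≤ r < τ (n = ⌊T/τ⌋);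
∫₀ᵀ g = n∫₀^τ g + ∫₀ʳ g(· + nτ) = n∫₀^τ g + ∫₀ʳ g (Function.Periodic.intervalIntegral_add_eq and
intervalIntegral.integral_comp_add_right); |∫₀ʳ g| ≤ τ·M with M = sup_{[0,τ]}|g| (continuous
periodic ⇒ bounded: Function.Periodic + IsCompact.exists_bound_of_continuousOn); so |timeMean g T −
τ⁻¹∫₀^τ g| ≤ (|∫₀^τ g|·|n/T − 1/τ| + τM/T) → 0 since nτ/T → 1; second conjunct from
Filter.Tendsto.limsup_eq. Used by E4' (2),(3) and by CoherentStates 0219/0221 (time-periodic exact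
solutions). A weaker hypothesis (g locally integrable and bounded) also works; continuity chosen for
a clean signature. Sources: folklore; DoeringFoias2002 §2 (long-time averages). -/
@[route_item "route-AnomalousDissipation-EulerLimit"]
def CesaroMeanPeriodic : Prop :=
  ∀ (g : ℝ → ℝ) (τ : ℝ), 0 < τ → Continuous g → Function.Periodic g τ → Filter.Tendsto (Literature.Analysis.FluidPDE.timeMean g) Filter.atTop (nhds (τ⁻¹ * ∫ t in (0 : ℝ)..τ, g t)) ∧ Literature.Analysis.FluidPDE.longTimeAvgSup g = τ⁻¹ * ∫ t in (0 : ℝ)..τ, g t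

/-- item stmt-AnomalousDissipation-1754 · support · rank 9 · open · by planner
[support] Glue, provable now (term-trivial projection: forget the Hölder and the
Duchon–Robert-defect conjuncts of the witness; checked in the planner Sketch, lean rc 0): the
realisation crux VanishingViscosityRealizationV2 (1507) implies thesis X = EulerlimitThesisV2
(0511); downstream, 0523 (Assembly4) turns X into AnomalousDissipation and all three of its
named-fact antecedents are DISCHARGED in Literature (IsClassicalNSSolutionOn.energy_balance_holds,
gradNormSq_eq_toReal_eGradNormSq_holds, isGlobalLerayHopf_of_isClassicalNSSolutionOn_holds), so
closing 1507 closes the route up to the elementary 0523. Likewise 1507 → 1516 → 0226 are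
term-trivial projections (not filed). -/
@[route_item "route-AnomalousDissipation-EulerLimit", crux]
def RealizationGivesThesis : Prop :=
  VanishingViscosityRealizationV2 → EulerlimitThesisV2

/-- item stmt-AnomalousDissipation-0523 · assembly · rank 1 · open · by planner
SUPERSEDES assembly stmt-AnomalousDissipation-0512 (grounder-ground-B-0, 07:14Z: 'lemma 0513's two
fact premises are NOT in this signature; if the prover cannot discharge energy_balance /
gradNormSq_eq_toReal_eGradNormSq they must be added here too — recommend planner add them now to
avoid a third re-filing'). Done: antecedents are now, in order, (ha :
Literature.Analysis.FunctionSpaces.Torus.IsClassicalNSSolutionOn.energy_balance (d := Fin 3)) (hb :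
Literature.Analysis.FunctionSpaces.Torus.gradNormSq_eq_toReal_eGradNormSq (d := Fin 3)) (h :
Literature.Analysis.FluidPDE.Torus.isGlobalLerayHopf_of_isClassicalNSSolutionOn), then X'' (= 0511
signature verbatim, junk-free F1 L³ clause) → AnomalousDissipation. ha, hb are `def … : Prop` named
facts in Literature/Analysis/FunctionSpaces/TorusFluidGlue.lean:230,132 (implicit {d}); h in
Literature/Analysis/FluidPDE/TorusClassicalLerayHopf.lean:48 (a Theorems file must import it). The
first two antecedents are character-identical to 0513's, the rest character-identical to 0512, so
the prover can `intro ha hb h hX` and apply 0513 ha hb and 0514 directly. Proof plan unchanged from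
0512 (grounder concurs, ~150 lines): (i) Hölder L³→L² on the fi -/
@[route_item "route-AnomalousDissipation-EulerLimit", crux]
def Assembly4 : Prop :=
  Literature.Analysis.FunctionSpaces.Torus.IsClassicalNSSolutionOn.energy_balance (d := Fin 3) → Literature.Analysis.FunctionSpaces.Torus.gradNormSq_eq_toReal_eGradNormSq (d := Fin 3) → Literature.Analysis.FluidPDE.Torus.isGlobalLerayHopf_of_isClassicalNSSolutionOn → (∃ f : UnitAddTorus (Fin 3) → EuclideanSpace ℝ (Fin 3), Literature.Analysis.FunctionSpaces.Torus.IsSmooth f ∧ Literature.Analysis.FunctionSpaces.Torus.IsDivFree f ∧ Literature.Analysis.FunctionSpaces.Torus.HasZeroMean f ∧ ∃ (τ : ℝ) (u : ℝ → UnitAddTorus (Fin 3) → EuclideanSpace ℝ (Fin 3)), 0 < τ ∧ Function.Periodic u τ ∧ (∀ T : ℝ, 0 < T → Literature.Analysis.FluidPDE.Torus.IsWeakNSSolutionForcedOn T 0 (fun _ => f) (u 0) u) ∧ 0 < ∫ t in (0 : ℝ)..τ, MeasureTheory.integral MeasureTheory.volume (fun x => inner ℝ (f x) (u t x)) ∧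 ∃ (ν : ℕ → ℝ) (us : ℕ → ℝ → UnitAddTorus (Fin 3) → EuclideanSpace ℝ (Fin 3)) (ps : ℕ → ℝ → UnitAddTorus (Fin 3) → ℝ), (∀ j, 0 < ν j) ∧ Filter.Tendsto ν Filter.atTop (nhds 0) ∧ (∀ j, Literature.Analysis.FunctionSpaces.Torus.IsClassicalNSSolutionOn Set.univ (ν j) (fun _ => f) (us j) (ps j) ∧ Function.Periodic (us j) τ) ∧ Filter.Tendsto (fun j => MeasureTheory.lintegral (MeasureTheory.Measure.restrict MeasureTheory.volume (Set.Ioo 0 τ)) (fun t => MeasureTheory.lintegral MeasureTheory.volume (fun x => ‖us j t x - u t x‖ₑ ^ 3))) Filter.atTop (nhds 0)) → AnomalousDissipation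

-- records of items no longer active in this route (dropped / restated):
-- earlier Assembly (stmt-AnomalousDissipation-0224, dropped 2026-08-16T14:43:05Z): moot by None — (∃ f : UnitAddTorus (Fin 3) → EuclideanSpace ℝ (Fin 3), Literature.Analysis.FunctionSpaces.Torus.IsSmooth f ∧ Literature.Analysis.FunctionSpaces.Torus.IsDivFree f ∧ Literature.Analysis.FunctionSpaces.Torus.HasZeroMean f ∧ ∃ (τ : ℝ) (u : ℝ → UnitAddTorus (Fin 3) → EuclideanSpace ℝ (Fin 3)), 0 < τ ∧ Funct
-- earlier Assembly2 (stmt-AnomalousDissipation-0439, dropped 2026-08-16T14:43:05Z): moot by None — Literature.Analysis.FluidPDE.Torus.isGlobalLerayHopf_of_isClassicalNSSolutionOn → (∃ f : UnitAddTorus (Fin 3) → EuclideanSpace ℝ (Fin 3), Literature.Analysis.FunctionSpaces.Torus.IsSmooth f ∧ Literature.Analysis.FunctionSpaces.Torus.IsDivFree f ∧ Literature.Analysis.FunctionSpaces.Torus.HasZeroMean f ∧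
-- earlier Assembly3 (stmt-AnomalousDissipation-0512, dropped 2026-08-16T14:43:05Z): moot by None — Literature.Analysis.FluidPDE.Torus.isGlobalLerayHopf_of_isClassicalNSSolutionOn → (∃ f : UnitAddTorus (Fin 3) → EuclideanSpace ℝ (Fin 3), Literature.Analysis.FunctionSpaces.Torus.IsSmooth f ∧ Literature.Analysis.FunctionSpaces.Torus.IsDivFree f ∧ Literature.Analysis.FunctionSpaces.Torus.HasZeroMean f ∧

/-! D-0027 §2.1 — DECIDING THEOREM (planner-authored via `route open/edit --closes-file`; by planner-rbadge-AnomalousDissipation-EulerLimit-5b23f787-g2-0 2026-08-15T16:15:05Z):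
its hypotheses are this route's items and its conclusion the sub-problem Statement (glue_lint), and it elaborates with this file. -/

@[closes "route-AnomalousDissipation-EulerLimit"] theorem closes : EulerlimitThesisV2 → VanishingViscosityRealizationV2 → GloballyDissipativePeriodicEulerFlow → RealizationGivesThesis → Assembly4 → _root_.AnomalousDissipation :=
  fun hX _hV _hG _hR hA =>
    hA Literature.Analysis.FunctionSpaces.Torus.IsClassicalNSSolutionOn.energy_balance_holds
      Literature.Analysis.FunctionSpaces.Torus.gradNormSq_eq_toReal_eGradNormSq_holds
      Literature.Analysis.FluidPDE.Torus.isGlobalLerayHopf_of_isClassicalNSSolutionOn_holds hX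

end Summit.AnomalousDissipation.AnomalousDissipation.Theses.EulerLimit
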